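import Literature.Combinatorics.SimpleGraph.HamiltonianParitySystemSound
import Literature.Combinatorics.SimpleGraph.HamiltonianParitySystemTour
import Literature.Combinatorics.SimpleGraph.HamiltonianSubdivision
import Literature.ModelTheory.FiniteModelTheory.CkEquivTransfer
import Literature.ModelTheory.FiniteModelTheory.XorLocalConsistency
import HarnessLib

/-!
# The Cai–Fürer–Immerman game on the parity–Hamiltonicity gadgets

Topic `Literature/ModelTheory/FiniteModelTheory`; the penultimate step (B4) of the discharge of the
named fact `AtseriasDawarOchremiak2021_hamiltonicity_countingWidth` (`CountingWidth.lean`; linear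
counting width of Hamiltonicity, Atserias–Dawar–Ochremiak 2021, Lemma 14 of arXiv:1901.07825).

For a parity system (`vr : Fin m → Fin 3 → Fin n`, right-hand sides `b`) the tree now has the gadget
digraph `XorHam.Arc vr b` (`HamiltonianParitySystem*.lean`): its split graph is Hamiltonian for `b = 0`,
not Hamiltonian unless `b` is a solution value, and the flip of the variables by `f` is an isomorphism
onto the gadget of the twisted system `twist f b`. Here we play Hella's bijective pebble game on the
(padded) split graphs of `Arc vr b` and `Arc vr 0`:

* `vdata vr x` — the variables a vertex knows about (one for chain vertices, the scope of `u` for block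
  vertices, none for connectors), `|vdata| ≤ 3`; `flipEquiv f` is a LOCAL flip action for it
  (`isLocalFlipAction_pad`), also after padding (`padEquiv`, `padD`);
* `arc_flip_zero_iff` — if `f` is CONSISTENT (`XorSystem.Good (scope vr) b s dom f`, file
  `XorLocalConsistency.lean`) on a domain containing the data of `x` and `y`, then
  `Arc vr 0 (flip f x) (flip f y) ↔ Arc vr b x y`: by equivariance the left side is an arc of the twisted
  system, whose right-hand side at every block touched is `b u + ∑ᵢ f (vr u i) = 0` because a consistent
  `f` satisfies the constraints inside its domain (Atserias–Dawar 2019, proof of Lemma 3.2);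
* `ckEquiv_padGraph` — **the transfer**: on an `(s, q/p)`-boundary expander, for `2pK ≤ qs` and
  `3k ≤ K`, the padded split graphs of `Arc vr b` and `Arc vr 0` are `≡^{C^k}` for EVERY `b` and every
  amount `r` of padding (`ckEquiv_of_consistencyFamily` of `CkEquivTransfer.lean` with the consistency
  family of `XorLocalConsistency.lean`);
* `isHamiltonian_padGraph_zero`, `exists_solution_of_isHamiltonian_padGraph` — the two Hamiltonicity
  facts survive the padding (`HamiltonianSubdivision.lean`).

## References

* A. Atserias, A. Dawar, J. Ochremiak, J. ACM 68 (2021), arXiv:1901.07825, §5.2 (Theorem 3, Lemma 14).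
* A. Atserias, A. Dawar, J. Log. Comput. 29 (2019), arXiv:1806.11307, Lemma 3.2 and its proof, Lemma 3.5.
* J.-Y. Cai, M. Fürer, N. Immerman, Combinatorica 12 (1992), §6.
-/

namespace Literature.ModelTheory.FiniteModelTheory

open Literature.Combinatorics.SimpleGraph Literature.Combinatorics.SimpleGraph.XorHam
open Literature.Combinatorics.SimpleGraph.XorHam.Vtx

namespace XorHamGame

variable {n m : ℕ} (vr : Fin m → Fin 3 → Fin n)

/-! ### Data of vertices and locality of the flips -/

/-- The scope of constraint `u` as a finite set of variables. [folklore] -/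
def scope (u : Fin m) : Finset (Fin n) := Finset.univ.image (vr u)

/-- A scope has at most three variables. [folklore] -/
theorem card_scope_le (u : Fin m) : (scope vr u).card ≤ 3 :=
  Finset.card_image_le.trans (by simp)

/-- **The data of a vertex**: the variables whose flips move it or change its arcs. [folklore] -/
def vdata : Vtx n m → Finset (Fin n)
  | cx _ => ∅
  | ce _ => ∅
  | hd v _ => {v}
  | tl v _ => {v}
  | nd _ o _ => {var vr o}
  | bx u _ _ => scope vr u
  | bm u _ _ _ => scope vr u

/-- Every vertex has at most three data variables. [folklore] -/
theorem card_vdata_le (x : Vtx n m) : (vdata vr x).card ≤ 3 := by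
  cases x <;> simp [vdata, card_scope_le]

/-- The block a vertex belongs to, if any. [folklore] -/
def blockOf : Vtx n m → Option (Fin m)
  | bx u _ _ => some u
  | bm u _ _ _ => some u
  | _ => none

variable {vr}

/-- A block vertex carries the scope of its block as data. [folklore] -/
theorem vdata_of_blockOf {x : Vtx n m} {u : Fin m} (h : blockOf x = some u) : vdata vr x = scope vr u := by
  cases x <;> simp only [blockOf, Option.some.injEq, reduceCtorEq] at h <;> subst h <;> rfl

/-- **Arcs depend on the right-hand sides only at the blocks of their ends.** [folklore] -/
theorem arc_congr_rhs {b b' : Fin m → ZMod 2} {x y : Vtx n m}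
    (h : ∀ u, (blockOf x = some u ∨ blockOf y = some u) → b u = b' u) : Arc vr b x y ↔ Arc vr b' x y := by
  cases x <;> cases y
  all_goals first
    | exact Iff.rfl
    | (simp only [Arc]; rw [h _ (Or.inl rfl)])

/-- Flips keep the block. [folklore] -/
theorem blockOf_flip (f : Fin n → ZMod 2) (x : Vtx n m) : blockOf (flip (vr := vr) f x) = blockOf x := by
  cases x <;> rfl

/-- Flips keep the data. [folklore] -/
theorem vdata_flip (f : Fin n → ZMod 2) (x : Vtx n m) : vdata vr (flip (vr := vr) f x) = vdata vr x := by
  cases x <;> rfl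

/-- The translation of a block depends only on the flips of its scope. [folklore] -/
theorem sigma_congr {f g : Fin n → ZMod 2} {u : Fin m} (h : ∀ v ∈ scope vr u, f v = g v) (ℓ : Fin 4) :
    sigma (vr := vr) f u ℓ = sigma (vr := vr) g u ℓ := by
  unfold sigma
  refine Finset.sum_congr rfl fun i _ => ?_
  rw [h (vr u i) (Finset.mem_image_of_mem _ (Finset.mem_univ i))]

/-- **Locality of the flips**: the image of `x` depends only on the flips of its data. [folklore] -/
theorem flip_congr {f g : Fin n → ZMod 2} {x : Vtx n m} (h : ∀ v ∈ vdata vr x, f v = g v) :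
    flip (vr := vr) f x = flip (vr := vr) g x := by
  cases x with
  | cx j => rfl
  | ce j => rfl
  | hd v a => simp only [XorHam.flip, h v (by simp [vdata])]
  | tl v a => simp only [XorHam.flip, h v (by simp [vdata])]
  | nd a o s => simp only [XorHam.flip, h (var vr o) (by simp [vdata])]
  | bx u ℓ s => simp only [XorHam.flip, sigma_congr h]
  | bm u i t t' => simp only [XorHam.flip, sigma_congr h]

/-! ### Consistent flips are partial isomorphisms onto the homogeneous gadget -/

/-- **The key compatibility** (Atserias–Dawar 2019, proof of Lemma 3.2, for this gadget): if `f` is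
consistent at radius `s ≥ 1` on a domain containing the data of `x` and `y`, then flipping by `f`
carries the arcs of `Arc vr b` between `x`, `y` exactly onto the arcs of the homogeneous gadget
`Arc vr 0`. [cite: AtseriasDawar2019, Lemma 3.2 (proof)] -/
theorem arc_flip_zero_iff (hvr : ∀ u, Function.Injective (vr u)) {b : Fin m → ZMod 2} {s : ℕ}
    (hs : 1 ≤ s) {dom : Finset (Fin n)} {f : Fin n → ZMod 2} (hg : XorSystem.Good (scope vr) b s dom f)
    {x y : Vtx n m} (hx : vdata vr x ⊆ dom) (hy : vdata vr y ⊆ dom) :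
    Arc vr 0 (flip (vr := vr) f x) (flip (vr := vr) f y) ↔ Arc vr b x y := by
  rw [← arc_flip_iff f x y]
  refine arc_congr_rhs fun u hu => ?_
  have hsub : scope vr u ⊆ dom := by
    rcases hu with hu | hu
    · rw [blockOf_flip] at hu; rw [← vdata_of_blockOf hu]; exact hx
    · rw [blockOf_flip] at hu; rw [← vdata_of_blockOf hu]; exact hy
  have hsum := hg.sum_scope_eq hs hsub
  rw [scope, Finset.sum_image fun i _ j _ e => hvr u e] at hsum
  show (0 : ZMod 2) = b u + ∑ i, f (vr u i)
  rw [hsum, CharTwo.add_self_eq_zero]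

/-! ### The split graphs, marked for padding -/

/-- The flip on split-graph vertices. [folklore] -/
def splitFlip (f : Fin n → ZMod 2) : Vtx n m × Fin 3 ≃ Vtx n m × Fin 3 :=
  (flipEquiv (vr := vr) f).prodCongr (Equiv.refl (Fin 3))

/-- The data of a split-graph vertex. [folklore] -/
def splitData (z : Vtx n m × Fin 3) : Finset (Fin n) := vdata vr z.1

/-- **Compatibility for the split graphs.** [cite: AtseriasDawar2019, Lemma 3.2 (proof)] -/
theorem splitGraph_adj_flip_iff (hvr : ∀ u, Function.Injective (vr u)) {b : Fin m → ZMod 2} {s : ℕ}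
    (hs : 1 ≤ s) {dom : Finset (Fin n)} {f : Fin n → ZMod 2} (hg : XorSystem.Good (scope vr) b s dom f)
    {x y : Vtx n m × Fin 3} (hx : splitData (vr := vr) x ⊆ dom) (hy : splitData (vr := vr) y ⊆ dom) :
    (splitGraph (Arc vr 0)).Adj (splitFlip (vr := vr) f x) (splitFlip (vr := vr) f y) ↔
      (splitGraph (Arc vr b)).Adj x y := by
  obtain ⟨x, i⟩ := x
  obtain ⟨y, j⟩ := y
  have h1 := arc_flip_zero_iff hvr hs hg hx hy
  have h2 := arc_flip_zero_iff hvr hs hg hy hx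
  simp only [splitFlip, Equiv.prodCongr_apply, Prod.map_apply, flipEquiv_apply, Equiv.refl_apply,
    splitGraph_adj_iff, splitRel, ne_eq, Prod.mk.injEq, h1, h2]
  simp only [← flipEquiv_apply, (flipEquiv (vr := vr) f).injective.eq_iff]

variable (vr)

/-- **The split graph of `Arc vr b`, marked** at the forced edge `(ce m)_out — (cx 0)_in` (the out-copy
of the last constraint connector has degree two). [folklore] -/
def marked (b : Fin m → ZMod 2) : Marked (Vtx n m × Fin 3) :=
  ⟨splitGraph (Arc vr b), (ce (Fin.last m), 2), (cx 0, 0), (ce (Fin.last m), 1)⟩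

variable {vr}

/-- The only arc out of the last constraint connector goes to `cx 0`. [folklore] -/
theorem arc_ce_last_out {b : Fin m → ZMod 2} {w : Vtx n m} : Arc vr b (ce (Fin.last m)) w ↔ w = cx 0 := by
  cases w with
  | cx j => simp only [Arc, true_and]; constructor <;> intro h <;> [rw [h]; exact (Vtx.cx.inj h)]
  | bx u ℓ s =>
    simp only [Arc, reduceCtorEq, iff_false, not_and]
    intro h; exact absurd h.symm (Fin.ne_of_lt (Fin.castSucc_lt_last u))
  | _ => simp [Arc]

/-- The marking is good: `(ce m)_out` has exactly the neighbours `(cx 0)_in ≠ (ce m)_mid`. [folklore] -/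
theorem marked_good (b : Fin m → ZMod 2) : (marked vr b).Good := by
  refine ⟨fun x => ?_, by simp [marked]⟩
  show (splitGraph (Arc vr b)).Adj (ce (Fin.last m), 2) x ↔ x = (cx 0, 0) ∨ x = (ce (Fin.last m), 1)
  rw [splitGraph_adj_out_iff]
  simp only [arc_ce_last_out]
  constructor
  · rintro (rfl | ⟨w, rfl, rfl⟩)
    · exact Or.inr rfl
    · exact Or.inl rfl
  · rintro (rfl | rfl)
    · exact Or.inr ⟨_, rfl, rfl⟩
    · exact Or.inl rfl

/-- The split graphs have at least three vertices. [folklore] -/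
theorem three_le_card : 3 ≤ Fintype.card (Vtx n m × Fin 3) := by
  rw [Fintype.card_prod, Fintype.card_fin, Vtx.card_vtx]; omega

/-- **The padded homogeneous gadget is Hamiltonian.** [folklore] -/
theorem isHamiltonian_padGraph_zero (vr : Fin m → Fin 3 → Fin n) (r : ℕ) :
    (padGraph (marked vr 0) r).IsHamiltonian :=
  (isHamiltonian_padGraph_iff (marked_good (vr := vr) 0) three_le_card r).2 (isHamiltonian_zero vr)

/-- **A Hamiltonian padded gadget solves the system.** [folklore] -/
theorem exists_solution_of_isHamiltonian_padGraph {b : Fin m → ZMod 2} {r : ℕ}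
    (h : (padGraph (marked vr b) r).IsHamiltonian) : ∃ x : Fin n → ZMod 2, ∀ u, ∑ i, x (vr u i) = b u :=
  exists_solution_of_isHamiltonian ((isHamiltonian_padGraph_iff (marked_good (vr := vr) b) three_le_card r).1 h)

/-! ### Flips and data on the padded graphs -/

section Pad

variable {V X : Type*}

/-- A permutation of the old vertices, extended by the identity on the padding. [folklore] -/
def padEquiv (φ : V ≃ V) : (r : ℕ) → PadV V r ≃ PadV V r
  | 0 => φ
  | r + 1 => (padEquiv φ r).optionCongr

/-- Data on the old vertices, extended by `∅` on the padding. [folklore] -/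
def padD (D : V → Finset X) : (r : ℕ) → PadV V r → Finset X
  | 0 => D
  | r + 1 => fun x => Option.elim x ∅ (padD D r)

/-- The padded data are bounded like the data. [folklore] -/
theorem card_padD_le {D : V → Finset X} {c₀ : ℕ} (hD : ∀ x, (D x).card ≤ c₀) :
    ∀ (r : ℕ) (x : PadV V r), (padD D r x).card ≤ c₀
  | 0, x => hD x
  | r + 1, none => by simp [padD]
  | r + 1, some x => card_padD_le hD r x

/-- The markings of the iterates do not depend on the graph. [folklore] -/
theorem iter_marks (G G' : _root_.SimpleGraph V) (a c a' : V) : ∀ r : ℕ,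
    ((⟨G, a, c, a'⟩ : Marked V).iter r).a = ((⟨G', a, c, a'⟩ : Marked V).iter r).a ∧
    ((⟨G, a, c, a'⟩ : Marked V).iter r).c = ((⟨G', a, c, a'⟩ : Marked V).iter r).c
  | 0 => ⟨rfl, rfl⟩
  | r + 1 => ⟨rfl, by
      show some ((⟨G, a, c, a'⟩ : Marked V).iter r).c = some _
      rw [(iter_marks G G' a c a' r).2]⟩

/-- The padded permutation fixes the marks when the permutation does. [folklore] -/
theorem padEquiv_marks (G : _root_.SimpleGraph V) {a c a' : V} {φ : V ≃ V} (ha : φ a = a) (hc : φ c = c) :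
    ∀ r : ℕ, padEquiv φ r ((⟨G, a, c, a'⟩ : Marked V).iter r).a = ((⟨G, a, c, a'⟩ : Marked V).iter r).a ∧
      padEquiv φ r ((⟨G, a, c, a'⟩ : Marked V).iter r).c = ((⟨G, a, c, a'⟩ : Marked V).iter r).c
  | 0 => ⟨ha, hc⟩
  | r + 1 => ⟨rfl, by
      show Option.map (padEquiv φ r) (some _) = some _
      rw [Option.map_some, (padEquiv_marks G ha hc r).2]⟩

/-- **Compatibility survives padding.** If `φ` fixes the marks and carries `G`-adjacency to
`G'`-adjacency between vertices with data in `dom`, then so does `padEquiv φ r` for the padded graphs.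
[folklore] -/
theorem padGraph_adj_iff {G G' : _root_.SimpleGraph V} {a c a' : V} {φ : V ≃ V} (ha : φ a = a) (hc : φ c = c)
    {D : V → Finset X} {dom : Finset X}
    (hφ : ∀ x y, D x ⊆ dom → D y ⊆ dom → (G'.Adj (φ x) (φ y) ↔ G.Adj x y)) :
    ∀ (r : ℕ) (x y : PadV V r), padD D r x ⊆ dom → padD D r y ⊆ dom →
      ((padGraph (⟨G', a, c, a'⟩ : Marked V) r).Adj (padEquiv φ r x) (padEquiv φ r y) ↔
        (padGraph (⟨G, a, c, a'⟩ : Marked V) r).Adj x y)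
  | 0, x, y, hx, hy => hφ x y hx hy
  | r + 1, x, y, hx, hy => by
    have hm := iter_marks G G' a c a' r
    have hfix := padEquiv_marks G (a' := a') ha hc r
    have hinj := (padEquiv φ r).injective
    have e1 : ∀ z, padEquiv φ r z = ((⟨G, a, c, a'⟩ : Marked V).iter r).a ↔
        z = ((⟨G, a, c, a'⟩ : Marked V).iter r).a := fun z => by
      conv_lhs => rw [← hfix.1]
      exact hinj.eq_iff
    have e2 : ∀ z, padEquiv φ r z = ((⟨G, a, c, a'⟩ : Marked V).iter r).c ↔
        z = ((⟨G, a, c, a'⟩ : Marked V).iter r).c := fun z => by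
      conv_lhs => rw [← hfix.2]
      exact hinj.eq_iff
    show (subdivide ((⟨G', a, c, a'⟩ : Marked V).iter r).G _ _).Adj (Option.map (padEquiv φ r) x)
        (Option.map (padEquiv φ r) y) ↔ (subdivide ((⟨G, a, c, a'⟩ : Marked V).iter r).G _ _).Adj x y
    rw [← hm.1, ← hm.2]
    cases x with
    | none =>
      cases y with
      | none => simp [subdivide]
      | some y =>
        simp only [Option.map_none, Option.map_some, subdivide_adj_none_some, e1, e2]
    | some x =>
      cases y with
      | none =>
        simp only [Option.map_none, Option.map_some, subdivide_adj_some_none, e1, e2]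
      | some y =>
        have ih : ((⟨G', a, c, a'⟩ : Marked V).iter r).G.Adj (padEquiv φ r x) (padEquiv φ r y) ↔
            ((⟨G, a, c, a'⟩ : Marked V).iter r).G.Adj x y := padGraph_adj_iff ha hc hφ r x y hx hy
        simp only [Option.map_some, subdivide_adj_some_some, ih, e1, e2]

/-- Locality survives padding. [folklore] -/
theorem isLocalFlipAction_pad {R : Type*} {D : V → Finset X} {φ : (X → R) → V ≃ V}
    (h : IsLocalFlipAction D φ) : ∀ r : ℕ, IsLocalFlipAction (padD D r) fun f => padEquiv (φ f) r
  | 0 => h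
  | r + 1 => by
    have ih := isLocalFlipAction_pad h r
    refine ⟨fun f g x hfg => ?_, fun f x => ?_⟩
    · cases x with
      | none => rfl
      | some x =>
        show some (padEquiv (φ f) r x) = some (padEquiv (φ g) r x)
        rw [ih.local_apply f g x hfg]
    · cases x with
      | none => rfl
      | some x => exact ih.data_apply f x

end Pad

/-! ### The transfer for the padded gadgets -/

/-- The flips form a local flip action on the split graphs. [folklore] -/
theorem isLocalFlipAction_split : IsLocalFlipAction (splitData (vr := vr)) (splitFlip (vr := vr)) := by
  refine ⟨fun f g x hfg => ?_, fun f x => ?_⟩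
  · obtain ⟨x, i⟩ := x
    show (flip (vr := vr) f x, i) = (flip (vr := vr) g x, i)
    rw [flip_congr hfg]
  · exact vdata_flip f x.1

/-- The consistency family of an expanding system (packaging `XorLocalConsistency.lean`).
[cite: AtseriasDawar2019, Lemma 3.5] -/
theorem isConsistencyFamily_good {U V : Type*} [DecidableEq U] [DecidableEq V] {S : U → Finset V}
    {b : U → ZMod 2} {s p q K : ℕ} (hq : 0 < q)
    (hexp : ∀ T : Finset U, T.card ≤ s → q * T.card ≤ p * (XorSystem.boundary S T).card)
    (hK : 2 * p * K ≤ q * s) : IsConsistencyFamily (XorSystem.Good S b s) K :=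
  ⟨XorSystem.good_empty hq hexp, fun _ _ _ h hsub => h.mono hsub, fun _ _ _ h hfg => h.congr hfg,
    fun _ _ h hcard v => XorSystem.good_extend hq hexp hK h hcard v⟩

/-- **The padded gadgets of a twisted and of the homogeneous system are `≡^{C^k}`** on an
`(s, q/p)`-boundary expander, whenever `2pK ≤ qs` and `3k ≤ K` — for every right-hand side `b` and every
amount of padding. (Atserias–Dawar–Ochremiak 2021, Theorem 3 / Atserias–Dawar 2019, Theorem 3.8, in the
form needed for Lemma 14: Duplicator flips by consistent partial assignments.)
[cite: AtseriasDawar2019, Lemma 3.2 with Lemma 3.5] -/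
theorem ckEquiv_padGraph (hvr : ∀ u, Function.Injective (vr u)) {s p q K k : ℕ} (hs : 1 ≤ s) (hq : 0 < q)
    (hexp : ∀ T : Finset (Fin m), T.card ≤ s → q * T.card ≤ p * (XorSystem.boundary (scope vr) T).card)
    (hK : 2 * p * K ≤ q * s) (hk : 3 * k ≤ K) (b : Fin m → ZMod 2) (r : ℕ) :
    CkEquiv k (padGraph (marked vr b) r) (padGraph (marked vr 0) r) := by
  classical
  have hG := isConsistencyFamily_good (S := scope vr) (b := b) hq hexp hK
  have hφ := isLocalFlipAction_pad (isLocalFlipAction_split (vr := vr)) r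
  refine ckEquiv_of_consistencyFamily (R := ZMod 2) hG hφ
    (card_padD_le (fun z : Vtx n m × Fin 3 => card_vdata_le vr z.1) r) (fun dom f x y hgood hx hy => ?_) hk
  have ha : splitFlip (vr := vr) f (ce (Fin.last m), 2) = (ce (Fin.last m), 2) := rfl
  have hc : splitFlip (vr := vr) f (cx 0, 0) = (cx 0, 0) := rfl
  exact padGraph_adj_iff (G := splitGraph (Arc vr b)) (G' := splitGraph (Arc vr 0))
    (a' := (ce (Fin.last m), 1)) ha hc
    (fun x y hx hy => splitGraph_adj_flip_iff hvr hs hgood hx hy) r x y hx hy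

end XorHamGame

end Literature.ModelTheory.FiniteModelTheory
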